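import Summits.AtomisticToContinuum.HydrodynamicLimit.Theorems.CollisionIsometryCLTAdaptedWeightCLTBHReynoldsBHPointwise
import Summits.AtomisticToContinuum.HydrodynamicLimit.Theorems.CollisionIsometryCLTAdaptedWeightCLTBHReynoldsBHGauss
import Summits.AtomisticToContinuum.HydrodynamicLimit.Theorems.CollisionIsometryCLTAdaptedWeightCLTSAReynoldsDynamics

/-!
# Equilibrium rung of `stub_reynoldsBH` (line `block-h-dissipation-closure`, crux stmt-AtomisticToContinuum-14868):
# the smeared Reynolds product at FIXED POSITIONS under independent Gaussian velocities

Support file (`--supports stmt-AtomisticToContinuum-14868`, anchor `bhReynoldsBH_zip_anchor`) of the stub worker of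
`stub_reynoldsBH`; third file of its EQUILIBRIUM RUNG (`…BHReynoldsBHPointwise`, `…BHReynoldsBHGauss`). At fixed
positions `p` and block centre `x`, under `⊗ᵢ N(u, θ𝟙)`:

* `lintegral_rtwoG_zip_le` — Tonelli in `(v, x')` and the quadratic cell bound:
  `E_v rtwoG ≤ 6θ ((N+1)⁻¹ Σᵢ φ_N(pᵢ − x) cᵢ + w_max/(N+1))`, `cᵢ = ∫ ψ_N(pᵢ − x') S(x') dx'` the smeared self-shares;
* `lintegral_envG_zip_le` — `E_v envG ≤ (3 + 3·2¹⁶ m₁₆) m₀`, `m₀ = (N+1)⁻¹ Σᵢ φ_N(pᵢ − x)` the block mass;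
* `lintegral_ethG_mul_reyG_zip_le` — with the pointwise bound of `…BHReynoldsBHPointwise`, for every `ε > 0`,
  `E_v (ethG · reyG) ≤ (3θ/ε) ((N+1)⁻¹ Σᵢ φ_N(pᵢ − x) cᵢ + w_max/(N+1)) + ε (16 m₀³ + 4 m₀)(3 + 3·2¹⁶ m₁₆) m₀`;
* `lintegral_lintegral_zip_le` — integrated over the block centre for positions whose blocks obey the density cap
  (`Reynolds.integral_blockShare`, the HEIGHT BOUND `Σᵢ cᵢ ≤ C' (N+1)^{3γc}` of `…BHReynoldsBHGauss`, no packing):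
  `∫ₓ E_v (ethG · reyG) ≤ (3θ/ε)(C' (N+1)^{3γc − 1} + C (N+1)^{3γ − 1}) + ε K(Dcap)`;
plus the joint measurability of `rtwoG`, `envG`, `ethG · reyG` in `(w, x)` (`StronglyMeasurable.integral_prod_right'`).

References: H. Spohn, *Large Scale Dynamics of Interacting Particles* (1991), Part I §2.3 [Spohn1991].
-/

namespace Summit.AtomisticToContinuum.HydrodynamicLimit.Theorems.BlockHDissipation

open scoped BigOperators Topology Classical MeasureTheory ENNReal InnerProductSpace
open Filter Set MeasureTheory ProbabilityTheory
open Literature.Analysis.FluidPDE Literature.Analysis.FluidPDE.Torus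
open Summit.AtomisticToContinuum.HydrodynamicLimit.Theorems.ContactSourceDuhamel
open Summit.AtomisticToContinuum.HydrodynamicLimit.Theorems.ContactSourceDuhamel.TimeLocal
open Summit.AtomisticToContinuum.HydrodynamicLimit.Theorems.ContactBalance
open Summit.AtomisticToContinuum.HydrodynamicLimit.Theorems.SustainedAnisotropy
open Literature.MathematicalPhysics.KineticTheory (gaussMeasure zipConfig zipConfig_apply measurable_zipConfig)

noncomputable section

namespace ReynoldsBH

/-! ## Joint measurability -/

section Meas

variable {N : ℕ} {φ ψ : ℕ → T3 → ℝ}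

/-- `rtwoG` is jointly measurable in `(w, x)`. -/
theorem measurable_rtwoG_prod (hφc : Continuous (φ N)) (hψc : Continuous (ψ N)) :
    Measurable fun q : Cfg N × T3 => rtwoG N φ ψ q.1 q.2 :=
  ((measurable_sq_integrand hφc hψc).stronglyMeasurable.integral_prod_right' (ν := (volume : Measure T3))).measurable

/-- `envG` is jointly measurable in `(w, x)`. -/
theorem measurable_envG_prod (hφc : Continuous (φ N)) (hψc : Continuous (ψ N)) :
    Measurable fun q : Cfg N × T3 => envG N φ ψ q.1 q.2 :=
  ((measurable_env_integrand hφc hψc).stronglyMeasurable.integral_prod_right' (ν := (volume : Measure T3))).measurable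

end Meas

/-! ## Fixed positions: Tonelli in `(v, x')` -/

section Zip

variable (u : V3) {θ : ℝ} {N : ℕ} {γ C γc C' : ℝ} {φ ψ : ℕ → T3 → ℝ} (p : Fin (N + 1) → T3) (x : T3)

/-- **`E_v rtwoG` AT FIXED POSITIONS**: `≤ 6θ ((N+1)⁻¹ Σᵢ φ_N(pᵢ − x) cᵢ + w_max/(N+1))`. -/
theorem lintegral_rtwoG_zip_le (hθ : 0 < θ) (hadm : AdmissibleKernel γ C φ) (hadmc : AdmissibleKernel γc C' ψ) :
    ∫⁻ v, ENNReal.ofReal (rtwoG N φ ψ (zipConfig (p, v)) x) ∂(Measure.pi fun _ : Fin (N + 1) => gaussMeasure u θ) ≤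
      ENNReal.ofReal (6 * θ * (((N + 1 : ℕ) : ℝ)⁻¹ * ∑ i, φ N (p i - x) * smearShareG N ψ p i +
        C * ((N : ℝ) + 1) ^ (3 * γ) / ((N + 1 : ℕ) : ℝ))) := by
  have hφc : Continuous (φ N) := (hadm.1 N).continuous
  have hψc : Continuous (ψ N) := (hadmc.1 N).continuous
  have hφ0 := hadm.2.1 N
  have hψ0 := hadmc.2.1 N
  have hψ1 := hadmc.2.2.1 N
  have hφC : ∀ y, φ N y ≤ C * ((N : ℝ) + 1) ^ (3 * γ) := hadm.2.2.2.2.1 N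
  have hψC : ∀ y, ψ N y ≤ C' * ((N : ℝ) + 1) ^ (3 * γc) := hadmc.2.2.2.2.1 N
  have hC0 : 0 ≤ C := Pointwise.admissible_C_nonneg hadm
  have hn : (0 : ℝ) ≤ ((N + 1 : ℕ) : ℝ)⁻¹ := by positivity
  have hMpos : (0 : ℝ) < ((N + 1 : ℕ) : ℝ) := by positivity
  have hwmax0 : 0 ≤ C * ((N : ℝ) + 1) ^ (3 * γ) := mul_nonneg hC0 (Real.rpow_nonneg (by positivity) _)
  have hW0 : 0 ≤ ∑ j, φ N (p j - x) := Finset.sum_nonneg fun j _ => hφ0 _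
  have hr0 : 0 ≤ C * ((N : ℝ) + 1) ^ (3 * γ) / ∑ j, φ N (p j - x) := div_nonneg hwmax0 hW0
  -- Step 1: `ofReal rtwoG = ∫⁻ x'`, Tonelli, the cell bound
  have hstep1 : ∀ v, ENNReal.ofReal (rtwoG N φ ψ (zipConfig (p, v)) x) =
      ∫⁻ x', ENNReal.ofReal (((N + 1 : ℕ) : ℝ)⁻¹ * ∑ i, wgtC N φ (zipConfig (p, v)) x i *
        (wgtC N ψ (zipConfig (p, v)) x' i *
          ‖ubarC N ψ (zipConfig (p, v)) x' - ubarC N φ (zipConfig (p, v)) x‖ ^ 2)) := fun v =>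
    ofReal_integral_eq_lintegral_ofReal (integrable_nuG hψc hψ0 (zipConfig (p, v)) x
      (K := fun _ _ z => ‖z - ubarC N φ (zipConfig (p, v)) x‖ ^ 2) fun i => by fun_prop)
      (ae_of_all _ fun x' => mul_nonneg hn (Finset.sum_nonneg fun i _ =>
        mul_nonneg (hφ0 _) (mul_nonneg (hψ0 _) (sq_nonneg _))))
  have hmeas := ((measurable_sq_integrand hφc hψc).comp (measurable_zip_pair p x)).ennreal_ofReal
  calc ∫⁻ v, ENNReal.ofReal (rtwoG N φ ψ (zipConfig (p, v)) x) ∂(Measure.pi fun _ : Fin (N + 1) => gaussMeasure u θ)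
      = ∫⁻ v, ∫⁻ x', ENNReal.ofReal (((N + 1 : ℕ) : ℝ)⁻¹ * ∑ i, wgtC N φ (zipConfig (p, v)) x i *
          (wgtC N ψ (zipConfig (p, v)) x' i *
            ‖ubarC N ψ (zipConfig (p, v)) x' - ubarC N φ (zipConfig (p, v)) x‖ ^ 2)) ∂(volume : Measure T3)
          ∂(Measure.pi fun _ : Fin (N + 1) => gaussMeasure u θ) := lintegral_congr hstep1
    _ = ∫⁻ x', ∫⁻ v, ENNReal.ofReal (((N + 1 : ℕ) : ℝ)⁻¹ * ∑ i, wgtC N φ (zipConfig (p, v)) x i *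
          (wgtC N ψ (zipConfig (p, v)) x' i *
            ‖ubarC N ψ (zipConfig (p, v)) x' - ubarC N φ (zipConfig (p, v)) x‖ ^ 2))
          ∂(Measure.pi fun _ : Fin (N + 1) => gaussMeasure u θ) ∂(volume : Measure T3) :=
        lintegral_lintegral_swap hmeas.aemeasurable
    _ ≤ ∫⁻ x', ENNReal.ofReal (((N + 1 : ℕ) : ℝ)⁻¹ * ∑ i, φ N (p i - x) * (ψ N (p i - x') *
          (6 * θ * (cellShareG N ψ p x' + C * ((N : ℝ) + 1) ^ (3 * γ) / ∑ j, φ N (p j - x))))) :=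
        lintegral_mono fun x' => lintegral_cell_sq_le u p x hθ hφ0 hφC hψ0 x'
    _ = ENNReal.ofReal (∫ x', ((N + 1 : ℕ) : ℝ)⁻¹ * ∑ i, φ N (p i - x) * (ψ N (p i - x') *
          (6 * θ * (cellShareG N ψ p x' + C * ((N : ℝ) + 1) ^ (3 * γ) / ∑ j, φ N (p j - x))))) := by
        -- Step 2: the bound is integrable in the cell centre
        refine (ofReal_integral_eq_lintegral_ofReal ?_ (ae_of_all _ fun x' => mul_nonneg hn
          (Finset.sum_nonneg fun i _ => mul_nonneg (hφ0 _) (mul_nonneg (hψ0 _) (mul_nonneg (by positivity)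
            (add_nonneg (cellShareG_nonneg p x') hr0)))))).symm
        refine (integrable_finsetSum _ fun i _ => (Integrable.congr (integrable_cell_test p hψc hψ0 hψC i (6 * θ)
          (6 * θ * (C * ((N : ℝ) + 1) ^ (3 * γ) / ∑ j, φ N (p j - x))))
          (ae_of_all _ fun x' => by ring)).const_mul (φ N (p i - x))).const_mul _
    _ ≤ _ := by
        -- Step 3: evaluate and bound
        refine ENNReal.ofReal_le_ofReal ?_
        have hint : ∀ i, Integrable fun x' => φ N (p i - x) * (ψ N (p i - x') *
            (6 * θ * (cellShareG N ψ p x' + C * ((N : ℝ) + 1) ^ (3 * γ) / ∑ j, φ N (p j - x)))) := fun i =>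
          (Integrable.congr (integrable_cell_test p hψc hψ0 hψC i (6 * θ)
            (6 * θ * (C * ((N : ℝ) + 1) ^ (3 * γ) / ∑ j, φ N (p j - x))))
            (ae_of_all _ fun x' => by ring)).const_mul (φ N (p i - x))
        have hev : ∀ i, ∫ x', φ N (p i - x) * (ψ N (p i - x') *
            (6 * θ * (cellShareG N ψ p x' + C * ((N : ℝ) + 1) ^ (3 * γ) / ∑ j, φ N (p j - x)))) =
            φ N (p i - x) * (6 * θ * smearShareG N ψ p i +
              6 * θ * (C * ((N : ℝ) + 1) ^ (3 * γ) / ∑ j, φ N (p j - x))) := fun i => by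
          rw [integral_const_mul, ← integral_cell_test p hψc hψ0 hψ1 hψC i]
          exact congrArg _ (integral_congr_ae (ae_of_all _ fun x' => by ring))
        rw [integral_const_mul, integral_finsetSum _ fun i _ => hint i]
        simp_rw [hev]
        -- `(N+1)⁻¹ Σ aᵢ (6θ cᵢ + 6θ wmax/W) ≤ 6θ ((N+1)⁻¹ Σ aᵢ cᵢ + wmax/(N+1))`
        have hsplit : ((N + 1 : ℕ) : ℝ)⁻¹ * ∑ i, φ N (p i - x) * (6 * θ * smearShareG N ψ p i +
            6 * θ * (C * ((N : ℝ) + 1) ^ (3 * γ) / ∑ j, φ N (p j - x))) =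
            6 * θ * (((N + 1 : ℕ) : ℝ)⁻¹ * ∑ i, φ N (p i - x) * smearShareG N ψ p i) +
            6 * θ * (((N + 1 : ℕ) : ℝ)⁻¹ * ((∑ i, φ N (p i - x)) *
              (C * ((N : ℝ) + 1) ^ (3 * γ) / ∑ j, φ N (p j - x)))) := by
          rw [Finset.sum_mul, Finset.mul_sum, Finset.mul_sum, Finset.mul_sum, Finset.mul_sum, Finset.mul_sum,
            ← Finset.sum_add_distrib]
          exact Finset.sum_congr rfl fun i _ => by ring
        rw [hsplit, mul_add]
        refine add_le_add le_rfl (mul_le_mul_of_nonneg_left ?_ (by positivity))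
        by_cases hW : ∑ j, φ N (p j - x) = 0
        · rw [hW, zero_mul, mul_zero]
          exact div_nonneg hwmax0 hMpos.le
        · rw [mul_div_cancel₀ _ hW, div_eq_inv_mul]

/-- **`E_v envG` AT FIXED POSITIONS**: `≤ (3 + 3 · 2¹⁶ m₁₆) m₀`. -/
theorem lintegral_envG_zip_le (hadm : AdmissibleKernel γ C φ) (hadmc : AdmissibleKernel γc C' ψ) :
    ∫⁻ v, ENNReal.ofReal (envG N φ ψ (zipConfig (p, v)) x) ∂(Measure.pi fun _ : Fin (N + 1) => gaussMeasure u θ) ≤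
      ENNReal.ofReal ((3 + 3 * (2 ^ 16 * ∫ w, ‖w - u‖ ^ 16 ∂gaussMeasure u θ)) *
        (((N + 1 : ℕ) : ℝ)⁻¹ * ∑ i, φ N (p i - x))) := by
  have hφc : Continuous (φ N) := (hadm.1 N).continuous
  have hψc : Continuous (ψ N) := (hadmc.1 N).continuous
  have hφ0 := hadm.2.1 N
  have hψ0 := hadmc.2.1 N
  have hψ1 := hadmc.2.2.1 N
  have hn : (0 : ℝ) ≤ ((N + 1 : ℕ) : ℝ)⁻¹ := by positivity
  obtain ⟨M16, hM16eq⟩ : ∃ M : ℝ, M = 2 ^ 16 * ∫ w, ‖w - u‖ ^ 16 ∂gaussMeasure u θ := ⟨_, rfl⟩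
  have hM16 : 0 ≤ M16 := by
    rw [hM16eq]; exact mul_nonneg (by positivity) (EqRung.integral_norm_sub_pow_nonneg u θ 16)
  have h33 : (0 : ℝ) ≤ 3 + 3 * M16 := by linarith
  rw [← hM16eq]
  have hstep1 : ∀ v, ENNReal.ofReal (envG N φ ψ (zipConfig (p, v)) x) =
      ∫⁻ x', ENNReal.ofReal (((N + 1 : ℕ) : ℝ)⁻¹ * ∑ i, wgtC N φ (zipConfig (p, v)) x i *
        (wgtC N ψ (zipConfig (p, v)) x' i *
          (3 + 2 * ‖(zipConfig (p, v) i).2 - ubarC N ψ (zipConfig (p, v)) x'‖ ^ 16 +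
            ‖ubarC N ψ (zipConfig (p, v)) x' - ubarC N φ (zipConfig (p, v)) x‖ ^ 16))) := fun v =>
    ofReal_integral_eq_lintegral_ofReal (integrable_nuG hψc hψ0 (zipConfig (p, v)) x
      (K := fun i _ z => 3 + 2 * ‖(zipConfig (p, v) i).2 - z‖ ^ 16 + ‖z - ubarC N φ (zipConfig (p, v)) x‖ ^ 16)
        fun i => by fun_prop)
      (ae_of_all _ fun x' => mul_nonneg hn (Finset.sum_nonneg fun i _ =>
        mul_nonneg (hφ0 _) (mul_nonneg (hψ0 _) (by positivity))))
  have hmeas := ((measurable_env_integrand hφc hψc).comp (measurable_zip_pair p x)).ennreal_ofReal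
  have hint : ∀ i, Integrable fun x' => φ N (p i - x) * (ψ N (p i - x') * (3 + 3 * M16)) := fun i =>
    ((PastDamping.integrable_of_continuous_T3 (hψc.comp (continuous_const.sub continuous_id))).mul_const
      _).const_mul _
  calc ∫⁻ v, ENNReal.ofReal (envG N φ ψ (zipConfig (p, v)) x) ∂(Measure.pi fun _ : Fin (N + 1) => gaussMeasure u θ)
      = ∫⁻ v, ∫⁻ x', ENNReal.ofReal (((N + 1 : ℕ) : ℝ)⁻¹ * ∑ i, wgtC N φ (zipConfig (p, v)) x i *
          (wgtC N ψ (zipConfig (p, v)) x' i *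
            (3 + 2 * ‖(zipConfig (p, v) i).2 - ubarC N ψ (zipConfig (p, v)) x'‖ ^ 16 +
              ‖ubarC N ψ (zipConfig (p, v)) x' - ubarC N φ (zipConfig (p, v)) x‖ ^ 16))) ∂(volume : Measure T3)
          ∂(Measure.pi fun _ : Fin (N + 1) => gaussMeasure u θ) := lintegral_congr hstep1
    _ = ∫⁻ x', ∫⁻ v, ENNReal.ofReal (((N + 1 : ℕ) : ℝ)⁻¹ * ∑ i, wgtC N φ (zipConfig (p, v)) x i *
          (wgtC N ψ (zipConfig (p, v)) x' i *
            (3 + 2 * ‖(zipConfig (p, v) i).2 - ubarC N ψ (zipConfig (p, v)) x'‖ ^ 16 +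
              ‖ubarC N ψ (zipConfig (p, v)) x' - ubarC N φ (zipConfig (p, v)) x‖ ^ 16)))
          ∂(Measure.pi fun _ : Fin (N + 1) => gaussMeasure u θ) ∂(volume : Measure T3) :=
        lintegral_lintegral_swap hmeas.aemeasurable
    _ ≤ ∫⁻ x', ENNReal.ofReal (((N + 1 : ℕ) : ℝ)⁻¹ * ∑ i, φ N (p i - x) * (ψ N (p i - x') * (3 + 3 * M16))) := by
        refine lintegral_mono fun x' => ?_
        have h := lintegral_cell_env_le u p x hφ0 hψ0 x' (θ := θ)
        rwa [← hM16eq] at h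
    _ = ENNReal.ofReal (∫ x', ((N + 1 : ℕ) : ℝ)⁻¹ * ∑ i, φ N (p i - x) * (ψ N (p i - x') * (3 + 3 * M16))) :=
        (ofReal_integral_eq_lintegral_ofReal ((integrable_finsetSum _ fun i _ => hint i).const_mul _)
          (ae_of_all _ fun x' => mul_nonneg hn (Finset.sum_nonneg fun i _ =>
            mul_nonneg (hφ0 _) (mul_nonneg (hψ0 _) h33)))).symm
    _ = ENNReal.ofReal ((3 + 3 * M16) * (((N + 1 : ℕ) : ℝ)⁻¹ * ∑ i, φ N (p i - x))) := by
        congr 1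
        rw [integral_const_mul, integral_finsetSum _ fun i _ => hint i]
        have hev : ∀ i, ∫ x', φ N (p i - x) * (ψ N (p i - x') * (3 + 3 * M16)) = φ N (p i - x) * (3 + 3 * M16) :=
          fun i => by
            rw [integral_const_mul, integral_mul_const, PastDamping.integral_comp_sub_left (ψ N) (p i), hψ1, one_mul]
        simp_rw [hev]
        rw [← Finset.sum_mul]
        ring

/-- **`E_v (ethG · reyG)` AT FIXED POSITIONS.** For every `ε > 0`:
`E_v (ethG · reyG) ≤ (ε⁻¹/2) · 6θ ((N+1)⁻¹ Σᵢ φ_N(pᵢ − x) cᵢ + w_max/(N+1)) + ε (16 m₀³ + 4 m₀)(3 + 3·2¹⁶ m₁₆) m₀`. -/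
theorem lintegral_ethG_mul_reyG_zip_le (hθ : 0 < θ) (hadm : AdmissibleKernel γ C φ)
    (hadmc : AdmissibleKernel γc C' ψ) {ε : ℝ} (hε : 0 < ε) :
    ∫⁻ v, ENNReal.ofReal (ethG N φ ψ (zipConfig (p, v)) x * reyG N φ ψ (zipConfig (p, v)) x)
        ∂(Measure.pi fun _ : Fin (N + 1) => gaussMeasure u θ) ≤
      ENNReal.ofReal (ε⁻¹ / 2 * (6 * θ * (((N + 1 : ℕ) : ℝ)⁻¹ * ∑ i, φ N (p i - x) * smearShareG N ψ p i +
          C * ((N : ℝ) + 1) ^ (3 * γ) / ((N + 1 : ℕ) : ℝ))) +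
        ε * (16 * (((N + 1 : ℕ) : ℝ)⁻¹ * ∑ i, φ N (p i - x)) ^ 3 + 4 * (((N + 1 : ℕ) : ℝ)⁻¹ * ∑ i, φ N (p i - x))) *
          ((3 + 3 * (2 ^ 16 * ∫ w, ‖w - u‖ ^ 16 ∂gaussMeasure u θ)) * (((N + 1 : ℕ) : ℝ)⁻¹ * ∑ i, φ N (p i - x)))) := by
  set μ := Measure.pi fun _ : Fin (N + 1) => gaussMeasure u θ with hμ
  have hφc : Continuous (φ N) := (hadm.1 N).continuous
  have hψc : Continuous (ψ N) := (hadmc.1 N).continuous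
  have hφ0 := hadm.2.1 N
  have hψ0 := hadmc.2.1 N
  have hψ1 := hadmc.2.2.1 N
  have hn : (0 : ℝ) ≤ ((N + 1 : ℕ) : ℝ)⁻¹ := by positivity
  obtain ⟨m₀, hm₀eq⟩ : ∃ m : ℝ, m = ((N + 1 : ℕ) : ℝ)⁻¹ * ∑ i, φ N (p i - x) := ⟨_, rfl⟩
  have hm₀ : 0 ≤ m₀ := by rw [hm₀eq]; exact mul_nonneg hn (Finset.sum_nonneg fun i _ => hφ0 _)
  have hm : ∀ v, massG N φ (zipConfig (p, v)) x = m₀ := fun v => by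
    rw [hm₀eq]
    unfold massG
    simp_rw [EqRung.wgtC_zipConfig]
  rw [← hm₀eq]
  set k : ℝ := ε * (16 * m₀ ^ 3 + 4 * m₀) with hk
  have hk0 : 0 ≤ k := by positivity
  have hε2 : 0 ≤ ε⁻¹ / 2 := by positivity
  have hmR : Measurable fun v : Fin (N + 1) → V3 => ENNReal.ofReal (ε⁻¹ / 2) *
      ENNReal.ofReal (rtwoG N φ ψ (zipConfig (p, v)) x) :=
    (((measurable_rtwoG_prod hφc hψc).comp (measurable_zip_left p x)).ennreal_ofReal).const_mul _
  calc ∫⁻ v, ENNReal.ofReal (ethG N φ ψ (zipConfig (p, v)) x * reyG N φ ψ (zipConfig (p, v)) x) ∂μ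
      ≤ ∫⁻ v, (ENNReal.ofReal (ε⁻¹ / 2) * ENNReal.ofReal (rtwoG N φ ψ (zipConfig (p, v)) x) +
          ENNReal.ofReal k * ENNReal.ofReal (envG N φ ψ (zipConfig (p, v)) x)) ∂μ := by
        refine lintegral_mono fun v => ?_
        have h := ethG_mul_reyG_le hψc hψ0 hψ1 hφ0 (zipConfig (p, v)) x hε
        rw [hm v] at h
        refine (ENNReal.ofReal_le_ofReal h).trans ?_
        rw [← ENNReal.ofReal_mul hε2, ← ENNReal.ofReal_mul hk0]
        exact ENNReal.ofReal_add_le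
    _ = ENNReal.ofReal (ε⁻¹ / 2) * ∫⁻ v, ENNReal.ofReal (rtwoG N φ ψ (zipConfig (p, v)) x) ∂μ +
          ENNReal.ofReal k * ∫⁻ v, ENNReal.ofReal (envG N φ ψ (zipConfig (p, v)) x) ∂μ := by
        rw [lintegral_add_left hmR, lintegral_const_mul' _ _ ENNReal.ofReal_ne_top,
          lintegral_const_mul' _ _ ENNReal.ofReal_ne_top]
    _ ≤ ENNReal.ofReal (ε⁻¹ / 2) * ENNReal.ofReal (6 * θ * (((N + 1 : ℕ) : ℝ)⁻¹ * ∑ i, φ N (p i - x) *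
            smearShareG N ψ p i + C * ((N : ℝ) + 1) ^ (3 * γ) / ((N + 1 : ℕ) : ℝ))) +
          ENNReal.ofReal k * ENNReal.ofReal ((3 + 3 * (2 ^ 16 * ∫ w, ‖w - u‖ ^ 16 ∂gaussMeasure u θ)) * m₀) := by
        refine add_le_add (mul_le_mul_right (lintegral_rtwoG_zip_le u p x hθ hadm hadmc) _)
          (mul_le_mul_right ?_ _)
        have h := lintegral_envG_zip_le u p x hadm hadmc (θ := θ)
        rwa [← hm₀eq] at h
    _ = _ := by
        have hC0 : 0 ≤ C := Pointwise.admissible_C_nonneg hadm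
        have hA0 : 0 ≤ 6 * θ * (((N + 1 : ℕ) : ℝ)⁻¹ * ∑ i, φ N (p i - x) * smearShareG N ψ p i +
            C * ((N : ℝ) + 1) ^ (3 * γ) / ((N + 1 : ℕ) : ℝ)) :=
          mul_nonneg (by positivity) (add_nonneg (mul_nonneg hn (Finset.sum_nonneg fun i _ =>
            mul_nonneg (hφ0 _) (smearShareG_nonneg p hψ0 i)))
            (div_nonneg (mul_nonneg hC0 (Real.rpow_nonneg (by positivity) _)) (by positivity)))
        have hm16 : 0 ≤ 2 ^ 16 * ∫ w, ‖w - u‖ ^ 16 ∂gaussMeasure u θ :=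
          mul_nonneg (by positivity) (EqRung.integral_norm_sub_pow_nonneg u θ 16)
        have hB0 : 0 ≤ (3 + 3 * (2 ^ 16 * ∫ w, ‖w - u‖ ^ 16 ∂gaussMeasure u θ)) * m₀ :=
          mul_nonneg (by linarith) hm₀
        rw [← ENNReal.ofReal_mul hε2, ← ENNReal.ofReal_mul hk0,
          ← ENNReal.ofReal_add (mul_nonneg hε2 hA0) (mul_nonneg hk0 hB0)]

end Zip

/-! ## The `x`-lower-integral of the Reynolds product is measurable in the configuration -/

section Meas

variable {N : ℕ} {φ ψ : ℕ → T3 → ℝ}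

/-- `(z, x) ↦ ethG · reyG` is jointly measurable. -/
theorem measurable_ethG_mul_reyG_prod (hφc : Continuous (φ N)) (hψc : Continuous (ψ N)) :
    Measurable fun q : Cfg N × T3 => ethG N φ ψ q.1 q.2 * reyG N φ ψ q.1 q.2 :=
  (Coarsening.measurable_ethG_prod hφc hψc).mul (Coarsening.measurable_reyG_prod hφc hψc)

/-- `z ↦ ∫⁻ₓ (ethG · reyG)` is measurable. -/
theorem measurable_lintegral_ethG_mul_reyG (hφc : Continuous (φ N)) (hψc : Continuous (ψ N)) :
    Measurable fun z : Cfg N => ∫⁻ x, ENNReal.ofReal (ethG N φ ψ z x * reyG N φ ψ z x) ∂(volume : Measure T3) :=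
  (measurable_ethG_mul_reyG_prod hφc hψc).ennreal_ofReal.lintegral_prod_right'

end Meas

/-! ## Integration over the block centre at fixed positions -/

section XIntegral

variable (u : V3) {θ : ℝ} {N : ℕ} {γ C γc C' : ℝ} {φ ψ : ℕ → T3 → ℝ}

/-- The constant of the envelope term is nonnegative: `0 ≤ K(D) = (16 D³ + 4 D)((3 + 3 M) D)` (`D, M ≥ 0`). -/
theorem envConst_nonneg {D M : ℝ} (hD : 0 ≤ D) (hM : 0 ≤ M) : 0 ≤ (16 * D ^ 3 + 4 * D) * ((3 + 3 * M) * D) := by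
  positivity

/-- The envelope term is monotone in the block mass: `0 ≤ m ≤ D ⇒ (16m³ + 4m)((3 + 3M) m) ≤ (16D³ + 4D)((3 + 3M) D)`. -/
theorem envTerm_mono {m D M : ℝ} (hm : 0 ≤ m) (hmD : m ≤ D) (hM : 0 ≤ M) :
    (16 * m ^ 3 + 4 * m) * ((3 + 3 * M) * m) ≤ (16 * D ^ 3 + 4 * D) * ((3 + 3 * M) * D) := by
  have hD : 0 ≤ D := hm.trans hmD
  have h1 : 16 * m ^ 3 + 4 * m ≤ 16 * D ^ 3 + 4 * D := by
    nlinarith [pow_le_pow_left₀ hm hmD 3]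
  exact mul_le_mul h1 (mul_le_mul_of_nonneg_left hmD (by positivity)) (by positivity) (by positivity)

/-- **THE BLOCK-CENTRE INTEGRAL AT FIXED POSITIONS** whose blocks all obey the density cap `m₀ ≤ Dcap`: for every
`ε > 0`, `∫ₓ E_v (ethG · reyG) ≤ (ε⁻¹/2) 6θ (C' (N+1)^{3γc}/(N+1) + C (N+1)^{3γ}/(N+1)) + ε K(Dcap)`
(Tonelli in `(v, x)`, the fixed-position bound, `∫ₓ φ_N(pᵢ − x) dx = 1`, and the height bound `Σᵢ cᵢ ≤ C'(N+1)^{3γc}`). -/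
theorem lintegral_lintegral_zip_le (hθ : 0 < θ) (hadm : AdmissibleKernel γ C φ) (hadmc : AdmissibleKernel γc C' ψ)
    (p : Fin (N + 1) → T3) {Dcap ε : ℝ} (hε : 0 < ε)
    (hcap : ∀ x : T3, ((N + 1 : ℕ) : ℝ)⁻¹ * ∑ i, φ N (p i - x) ≤ Dcap) :
    ∫⁻ v, ∫⁻ x, ENNReal.ofReal (ethG N φ ψ (zipConfig (p, v)) x * reyG N φ ψ (zipConfig (p, v)) x)
        ∂(volume : Measure T3) ∂(Measure.pi fun _ : Fin (N + 1) => gaussMeasure u θ) ≤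
      ENNReal.ofReal (ε⁻¹ / 2 * (6 * θ * (C' * ((N : ℝ) + 1) ^ (3 * γc) / ((N + 1 : ℕ) : ℝ) +
          C * ((N : ℝ) + 1) ^ (3 * γ) / ((N + 1 : ℕ) : ℝ))) +
        ε * ((16 * Dcap ^ 3 + 4 * Dcap) * ((3 + 3 * (2 ^ 16 * ∫ w, ‖w - u‖ ^ 16 ∂gaussMeasure u θ)) * Dcap))) := by
  set μ := Measure.pi fun _ : Fin (N + 1) => gaussMeasure u θ with hμ
  have hφc : Continuous (φ N) := (hadm.1 N).continuous
  have hψc : Continuous (ψ N) := (hadmc.1 N).continuous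
  have hφ0 := hadm.2.1 N
  have hψ0 := hadmc.2.1 N
  have hC0 : 0 ≤ C := Pointwise.admissible_C_nonneg hadm
  have hC0' : 0 ≤ C' := Pointwise.admissible_C_nonneg hadmc
  have hψC : ∀ y, ψ N y ≤ C' * ((N : ℝ) + 1) ^ (3 * γc) := hadmc.2.2.2.2.1 N
  have hn : (0 : ℝ) ≤ ((N + 1 : ℕ) : ℝ)⁻¹ := by positivity
  have hMpos : (0 : ℝ) < ((N + 1 : ℕ) : ℝ) := by positivity
  have hD0 : 0 ≤ Dcap := (mul_nonneg hn (Finset.sum_nonneg fun i _ => hφ0 (p i - 0))).trans (hcap 0)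
  obtain ⟨K, hKeq⟩ : ∃ K : ℝ, K = (16 * Dcap ^ 3 + 4 * Dcap) *
      ((3 + 3 * (2 ^ 16 * ∫ w, ‖w - u‖ ^ 16 ∂gaussMeasure u θ)) * Dcap) := ⟨_, rfl⟩
  have hK0 : 0 ≤ K := by rw [hKeq]; exact envConst_nonneg hD0 (m16_nonneg u)
  rw [← hKeq]
  obtain ⟨wM, hwMeq⟩ : ∃ w : ℝ, w = C * ((N : ℝ) + 1) ^ (3 * γ) / ((N + 1 : ℕ) : ℝ) := ⟨_, rfl⟩
  have hwM0 : 0 ≤ wM := by rw [hwMeq]; exact div_nonneg (mul_nonneg hC0 (Real.rpow_nonneg (by positivity) _)) hMpos.le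
  rw [← hwMeq]
  set c : Fin (N + 1) → ℝ := fun i => smearShareG N ψ p i with hc
  have hc0 : ∀ i, 0 ≤ c i := fun i => smearShareG_nonneg p hψ0 i
  set F : T3 → ℝ := fun x => ((N + 1 : ℕ) : ℝ)⁻¹ * ∑ i, φ N (p i - x) * c i with hF
  have hFc : Continuous F := by rw [hF]; fun_prop
  have hF0 : ∀ x, 0 ≤ F x := fun x => mul_nonneg hn (Finset.sum_nonneg fun i _ => mul_nonneg (hφ0 _) (hc0 i))
  have hε2 : 0 ≤ ε⁻¹ / 2 := by positivity
  -- Tonelli in `(v, x)`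
  have hmeas : AEMeasurable (Function.uncurry fun (v : Fin (N + 1) → V3) (x : T3) =>
      ENNReal.ofReal (ethG N φ ψ (zipConfig (p, v)) x * reyG N φ ψ (zipConfig (p, v)) x))
      (μ.prod (volume : Measure T3)) := by
    have hz : Measurable fun q : (Fin (N + 1) → V3) × T3 => (zipConfig (p, q.1), q.2) :=
      (measurable_zipConfig.comp (measurable_const.prodMk measurable_fst)).prodMk measurable_snd
    exact ((measurable_ethG_mul_reyG_prod hφc hψc).comp hz).ennreal_ofReal.aemeasurable
  rw [lintegral_lintegral_swap hmeas]
  -- the fixed-position bound, uniformised by the cap, is continuous in the block centre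
  have hpt : ∀ x, ∫⁻ v, ENNReal.ofReal (ethG N φ ψ (zipConfig (p, v)) x * reyG N φ ψ (zipConfig (p, v)) x) ∂μ ≤
      ENNReal.ofReal (ε⁻¹ / 2 * (6 * θ * (F x + wM)) + ε * K) := fun x => by
    have h := lintegral_ethG_mul_reyG_zip_le u p x hθ hadm hadmc hε
    rw [← hwMeq] at h
    refine h.trans (ENNReal.ofReal_le_ofReal (add_le_add le_rfl ?_))
    rw [mul_assoc, hKeq]
    exact mul_le_mul_of_nonneg_left (envTerm_mono (mul_nonneg hn (Finset.sum_nonneg fun i _ => hφ0 _))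
      (hcap x) (m16_nonneg u)) hε.le
  have hint : Integrable (fun x => ε⁻¹ / 2 * (6 * θ * (F x + wM)) + ε * K) (volume : Measure T3) :=
    PastDamping.integrable_of_continuous_T3 (by fun_prop)
  have hnn : ∀ x, 0 ≤ ε⁻¹ / 2 * (6 * θ * (F x + wM)) + ε * K := fun x => by
    have := hF0 x
    positivity
  calc ∫⁻ x, ∫⁻ v, ENNReal.ofReal (ethG N φ ψ (zipConfig (p, v)) x * reyG N φ ψ (zipConfig (p, v)) x) ∂μ
        ∂(volume : Measure T3)
      ≤ ∫⁻ x, ENNReal.ofReal (ε⁻¹ / 2 * (6 * θ * (F x + wM)) + ε * K) ∂(volume : Measure T3) := lintegral_mono hpt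
    _ = ENNReal.ofReal (∫ x, (ε⁻¹ / 2 * (6 * θ * (F x + wM)) + ε * K) ∂(volume : Measure T3)) :=
        (ofReal_integral_eq_lintegral_ofReal hint (ae_of_all _ hnn)).symm
    _ = ENNReal.ofReal (ε⁻¹ / 2 * (6 * θ * (((N + 1 : ℕ) : ℝ)⁻¹ * ∑ i, c i + wM)) + ε * K) := by
        congr 1
        have hFi : Integrable F (volume : Measure T3) := PastDamping.integrable_of_continuous_T3 hFc
        have e : ∀ x, ε⁻¹ / 2 * (6 * θ * (F x + wM)) + ε * K =
            (ε⁻¹ / 2 * (6 * θ)) * F x + (ε⁻¹ / 2 * (6 * θ) * wM + ε * K) := fun x => by ring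
        simp_rw [e]
        rw [integral_add (hFi.const_mul _) (integrable_const _), integral_const_mul, integral_const, probReal_univ,
          one_smul, hF, Reynolds.integral_blockShare hadm N p c]
        ring
    _ ≤ _ := by
        refine ENNReal.ofReal_le_ofReal (add_le_add (mul_le_mul_of_nonneg_left (mul_le_mul_of_nonneg_left
          (add_le_add ?_ le_rfl) (by positivity)) hε2) le_rfl)
        -- the height bound of the smeared self-shares
        rw [div_eq_inv_mul]
        exact mul_le_mul_of_nonneg_left (sum_smearShareG_le p hψc hψ0 hψC) hn

end XIntegral

end ReynoldsBH

/-- Registered anchor of this helper file (`--supports stmt-AtomisticToContinuum-14868`): the quadratic smeared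
fluctuation at fixed positions under independent Gaussian velocities (`ReynoldsBH.lintegral_rtwoG_zip_le`). -/
theorem bhReynoldsBH_zip_anchor : ∀ (u : V3) (θ : ℝ) (N : ℕ) (γ C γc C' : ℝ) (φ ψ : ℕ → T3 → ℝ) (p : Fin (N + 1) → T3) (x : T3), 0 < θ → AdmissibleKernel γ C φ → AdmissibleKernel γc C' ψ → ∫⁻ v, ENNReal.ofReal (rtwoG N φ ψ (Literature.MathematicalPhysics.KineticTheory.zipConfig (p, v)) x) ∂(Measure.pi fun _ : Fin (N + 1) => Literature.MathematicalPhysics.KineticTheory.gaussMeasure u θ) ≤ ENNReal.ofReal (6 * θ * (((N + 1 : ℕ) : ℝ)⁻¹ * ∑ i, φ N (p i - x) * smearShareG N ψ p i + C * ((N : ℝ) + 1) ^ (3 * γ) / ((N + 1 : ℕ) : ℝ))) :=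
  fun u _ _ _ _ _ _ _ _ p x hθ hadm hadmc => ReynoldsBH.lintegral_rtwoG_zip_le u p x hθ hadm hadmc

end

end Summit.AtomisticToContinuum.HydrodynamicLimit.Theorems.BlockHDissipation
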